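import Summits.CriticalPhenomena.PercolationContinuityZ3.Theorems.PercNearOneGluingNoHeavyLowerTailFKKNConj4Designated
import Summits.CriticalPhenomena.PercolationContinuityZ3.Theorems.PercNearOneGluingNoHeavyLowerTailGpsiAllWeights
import HarnessLib

/-!
# FK sub-lane: Kozma–Nitzan's Conjecture 4 in DESIGNATED form and QUESTION 7 for `φ_{w,q}`, `q ≥ 1`, EVERY parameter vector

Support file (`--supports stmt-CriticalPhenomena-4575`), FK sub-lane `prim-bschramm-fk-2` (gen 5) of the post-continuity programme;
builds on p205010 (kernel theorem, internal audit signed; external expert review pending).  No definitions, no named facts, no sorries;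
standard axioms.  Port of prim-cplus-coupling's closure `Q7Psi.gpsi_of_nondegenerate` (`…NoHeavyLowerTailGpsiAllWeights.lean`) from
`prodBernoulli` to the random-cluster measures `φ_{w,q} = rcMeasureW w q ∅`, `q ≥ 1`.

The designated hypothesis "`c` has least mean" is not stable under perturbation of the parameters (ties may break the wrong way), so plain
continuity does not suffice; as at `q = 1` one perturbs the FUNCTIONAL: with `T = {u | φ(c ↔ u) = 1}` and `F_t = F − t·1{· ⊆ T}` (monotone), at
the given parameters the relays of least `F_t`-mean lie in `A ∩ T`, with a gap `t·φ(C c ⊆ T) > 0` — positivity by FKG for the DECREASING events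
`{c ↮ u}` under `φ_{w,q}`, `q ≥ 1` (`FK.rcMeasureW_prod_le_real_iInter_of_isLowerSet`, in place of Harris); the gap persists at nearby non-degenerate
parameters (continuity of finite sums of point masses, `BHK2006.continuous_sum_rcMass`), where the hypothesis applies to the minimiser `c_p ∈ A ∩ T`;
a relay of `A ∩ T` recurring along `p → w` satisfies the inequality at `w` (closedness) and is interchangeable with `c` (`φ(c ↔ a) = 1`: equal
clusters almost surely); finally `t → 0`.

* `FK.rcMeasureW_real_lower_inter`, `FK.rcMeasureW_prod_le_real_iInter_of_isLowerSet` — FKG for decreasing events under `φ^B_{w,q}`, `q ≥ 1`;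
* `FK.gpsi_rc_of_nondegenerate` — the closure over degenerate parameters, designated form;
* **`FK.kn_conj4_designated_rc`** — Conjecture 4 in designated form for `φ_{w,q}`, `q ≥ 1`, EVERY `w ∈ [0,1]^{Sym2 (Fin n)}`;
* **`FK.kn_question7_rc`** — QUESTION 7 (display (41)) for `φ_{w,q}`, `q ≥ 1`, every `w`, every `|A|`;
* `FK.kn_conj2_designated_rc` — Conjecture 2 / display (3) with the witness NAMED (the a-priori least `b`-reliable relay).
[cite: KozmaNitzan2024, Conj. 4 (p. 32), Question 7 and display (41) (p. 36), Conj. 2 (p. 3)] [cite: Grimmett2006, §1.4 eq. (1.20) (p. 15); Thm. (3.8)]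
-/

namespace Summit.CriticalPhenomena.PercolationContinuityZ3.Theorems

open MeasureTheory Set Filter Topology Literature.Probability.LatticeModels Literature.Probability.Percolation
open scoped Classical

noncomputable section

namespace FK

variable {V : Type*} [Fintype V]

/-- **FKG for two DECREASING events under `φ^B_{w,q}`, `q ≥ 1`** (every `w ∈ [0,1]^{Sym2 V}`): `φ(D) φ(D') ≤ φ(D ∩ D')` — from `rcMeasureW_fkg`
for the complements by inclusion–exclusion. [cite: Grimmett2006, Thm. (3.8) (p. 16)] -/
theorem rcMeasureW_real_lower_inter (w : Sym2 V → unitInterval) {q : ℝ} (hq : 1 ≤ q) (B : Set V) {D D' : Set (BondConfig V)}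
    (hD : IsLowerSet D) (hD' : IsLowerSet D') :
    (rcMeasureW w q B).real D * (rcMeasureW w q B).real D' ≤ (rcMeasureW w q B).real (D ∩ D') := by
  have hq0 : 0 < q := one_pos.trans_le hq
  haveI := isProbabilityMeasure_rcMeasureW w hq0 B
  set μ := rcMeasureW w q B with hμ
  have hmeas : ∀ S : Set (BondConfig V), MeasurableSet S := fun _ => MeasurableSet.of_discrete
  have hfkg := rcMeasureW_fkg w hq B hD.compl hD'.compl
  have hA : μ.real Dᶜ = 1 - μ.real D := by rw [measureReal_compl (hmeas _), probReal_univ]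
  have hA' : μ.real D'ᶜ = 1 - μ.real D' := by rw [measureReal_compl (hmeas _), probReal_univ]
  have hIE : μ.real (Dᶜ ∪ D'ᶜ) + μ.real (Dᶜ ∩ D'ᶜ) = μ.real Dᶜ + μ.real D'ᶜ := measureReal_union_add_inter (hmeas _)
  have hU : μ.real (Dᶜ ∪ D'ᶜ) = 1 - μ.real (D ∩ D') := by
    rw [← compl_inter, measureReal_compl (hmeas _), probReal_univ]
  rw [← hμ] at hfkg
  rw [hA, hA'] at hfkg hIE
  rw [hU] at hIE
  nlinarith [hfkg, hIE]

/-- **FKG product bound for finitely many DECREASING events under `φ^B_{w,q}`, `q ≥ 1`**: `∏_k φ(D_k) ≤ φ(⋂_k D_k)`.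
[cite: Grimmett2006, Thm. (3.8) (p. 16)] -/
theorem rcMeasureW_prod_le_real_iInter_of_isLowerSet {κ : Type*} (w : Sym2 V → unitInterval) {q : ℝ} (hq : 1 ≤ q) (B : Set V)
    (s : Finset κ) {D : κ → Set (BondConfig V)} (hD : ∀ k ∈ s, IsLowerSet (D k)) :
    ∏ k ∈ s, (rcMeasureW w q B).real (D k) ≤ (rcMeasureW w q B).real (⋂ k ∈ s, D k) := by
  classical
  have hq0 : 0 < q := one_pos.trans_le hq
  haveI := isProbabilityMeasure_rcMeasureW w hq0 B
  induction s using Finset.induction_on with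
  | empty => simp
  | @insert k s hk ih =>
    rw [Finset.prod_insert hk]
    have hDs : ∀ k' ∈ s, IsLowerSet (D k') := fun k' hk' => hD k' (Finset.mem_insert_of_mem hk')
    have hI : IsLowerSet (⋂ k' ∈ s, D k') := isLowerSet_iInter₂ fun k' hk' => hDs k' hk'
    have h1 := ih hDs
    have h2 := rcMeasureW_real_lower_inter w hq B (hD k (Finset.mem_insert_self k s)) hI
    have heq : (⋂ k' ∈ insert k s, D k') = D k ∩ ⋂ k' ∈ s, D k' := by
      rw [Finset.set_biInter_insert]
    rw [heq]
    exact le_trans (mul_le_mul_of_nonneg_left h1 measureReal_nonneg) h2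

/-- If `μ(c ↔ a) = 1` under a probability measure then `C(a) = C(c)` almost surely. [folklore] -/
theorem openCluster_ae_eq_of_real_openConn_eq_one' (μ : Measure (BondConfig V)) [IsProbabilityMeasure μ] {c a : V}
    (h : μ.real (openConn c a) = 1) : ∀ᵐ ω ∂μ, openCluster ω a = openCluster ω c := by
  have h1 : μ (openConn c a) = 1 := by
    rwa [measureReal_def, ENNReal.toReal_eq_one_iff] at h
  have h0 : μ (openConn c a : Set (BondConfig V))ᶜ = 0 := (prob_compl_eq_zero_iff MeasurableSet.of_discrete).2 h1
  have hmem : (openConn c a : Set (BondConfig V)) ∈ ae μ := mem_ae_iff.2 h0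
  filter_upwards [hmem] with ω hω
  exact (KNPreFKG.openCluster_eq_of_reachable hω).symm

variable {n : ℕ}

/-- **Closure over degenerate parameters for the designated inequality under `φ_{w,q}`, `q ≥ 1`.**  If, for every NON-DEGENERATE parameter
vector `p` (all `0 < p e < 1`), every relay set `A`, observer `o`, monotone real cluster property `F` and relay `c ∈ A` of least `φ_{p,q}`-mean,
`∫_{o↔A} F(C c) dφ_{p,q} ≤ ∫_{o↔A} F(C o) dφ_{p,q}`, then the same holds for EVERY `w : Sym2 (Fin n) → [0,1]`.  (Port of `Q7Psi.gpsi_of_nondegenerate`: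
perturb the functional by `t·1{· ⊆ T}`, `T` = the almost-sure companions of `c`; FKG for decreasing events gives the gap; continuity of point masses.)
[cite: KozmaNitzan2024, Conjecture 4 (p. 32), Question 7 (p. 36)] [cite: Grimmett2006, Thm. (3.8) (p. 16); §1.4 eq. (1.20) (p. 15)] -/
theorem gpsi_rc_of_nondegenerate {q : ℝ} (hq : 1 ≤ q)
    (hND : ∀ p : Sym2 (Fin n) → unitInterval, (∀ e, 0 < p e ∧ p e < 1) →
      ∀ (A : Finset (Fin n)) (o c : Fin n) (F : Set (Fin n) → ℝ), (∀ S T : Set (Fin n), S ⊆ T → F S ≤ F T) → c ∈ A →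
        (∀ a ∈ A, ∫ ω, F (openCluster ω c) ∂(rcMeasureW p q ∅) ≤ ∫ ω, F (openCluster ω a) ∂(rcMeasureW p q ∅)) →
        ∫ ω in ⋃ a ∈ A, openConn o a, F (openCluster ω c) ∂(rcMeasureW p q ∅) ≤
          ∫ ω in ⋃ a ∈ A, openConn o a, F (openCluster ω o) ∂(rcMeasureW p q ∅))
    (w : Sym2 (Fin n) → unitInterval) (A : Finset (Fin n)) (o c : Fin n) (F : Set (Fin n) → ℝ)
    (hF : ∀ S T : Set (Fin n), S ⊆ T → F S ≤ F T) (hcA : c ∈ A)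
    (hmin : ∀ a ∈ A, ∫ ω, F (openCluster ω c) ∂(rcMeasureW w q ∅) ≤ ∫ ω, F (openCluster ω a) ∂(rcMeasureW w q ∅)) :
    ∫ ω in ⋃ a ∈ A, openConn o a, F (openCluster ω c) ∂(rcMeasureW w q ∅) ≤
      ∫ ω in ⋃ a ∈ A, openConn o a, F (openCluster ω o) ∂(rcMeasureW w q ∅) := by
  have hq0 : 0 < q := one_pos.trans_le hq
  haveI hprob : ∀ p : Sym2 (Fin n) → unitInterval, IsProbabilityMeasure (rcMeasureW p q ∅) :=
    fun p => isProbabilityMeasure_rcMeasureW p hq0 ∅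
  set μ := rcMeasureW w q ∅ with hμ
  have hmeas : ∀ E : Set (BondConfig (Fin n)), MeasurableSet E := fun _ => MeasurableSet.of_discrete
  have hint : ∀ (g : BondConfig (Fin n) → ℝ) (ν : Measure (BondConfig (Fin n))) [IsFiniteMeasure ν], Integrable g ν :=
    fun g ν _ => Integrable.of_finite
  set J : Set (BondConfig (Fin n)) := ⋃ a ∈ A, (openConn o a : Set (BondConfig (Fin n))) with hJ
  -- the almost-sure companions of `c`
  set T : Set (Fin n) := {u | μ.real (openConn c u) = 1} with hT
  have hcT : c ∈ T := by
    show μ.real (openConn c c) = 1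
    have : (openConn c c : Set (BondConfig (Fin n))) = univ := eq_univ_of_forall fun ω => SimpleGraph.Reachable.refl c
    rw [this, probReal_univ]
  -- `φ(C c ⊆ T) > 0` (FKG for the decreasing events `{c ↮ u}`, `u ∉ T`)
  set Tc : Finset (Fin n) := Finset.univ.filter (fun u => u ∉ T) with hTc
  have hsub : {ω : BondConfig (Fin n) | openCluster ω c ⊆ T} = ⋂ u ∈ Tc, (openConn c u : Set (BondConfig (Fin n)))ᶜ := by
    ext ω
    simp only [mem_setOf_eq, mem_iInter, mem_compl_iff, hTc, Finset.mem_filter, Finset.mem_univ, true_and]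
    constructor
    · intro h u huT hcu
      exact huT (h hcu)
    · intro h z hz
      by_contra hzT
      exact h z hzT hz
  have hpos : 0 < μ.real {ω : BondConfig (Fin n) | openCluster ω c ⊆ T} := by
    rw [hsub]
    refine lt_of_lt_of_le ?_ (rcMeasureW_prod_le_real_iInter_of_isLowerSet w hq ∅ Tc
      (fun u _ => (isUpperSet_openConn c u).compl))
    refine Finset.prod_pos fun u hu => ?_
    have huT : μ.real (openConn c u) ≠ 1 := (Finset.mem_filter.1 hu).2
    have hle : μ.real (openConn c u) ≤ 1 := measureReal_le_one
    rw [measureReal_compl (hmeas _), probReal_univ]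
    exact sub_pos.2 (lt_of_le_of_ne hle huT)
  -- it suffices to prove the inequality up to an arbitrary `t > 0`
  suffices key : ∀ t : ℝ, 0 < t →
      (∫ ω in J, F (openCluster ω c) ∂μ) ≤ (∫ ω in J, F (openCluster ω o) ∂μ) + t by
    exact le_of_forall_pos_le_add key
  intro t ht
  -- the perturbed functional `F_t = F − t · 1{· ⊆ T}` (monotone)
  set G : Set (Fin n) → ℝ := fun S => F S - t * (if S ⊆ T then 1 else 0) with hG
  have hGmono : ∀ S S' : Set (Fin n), S ⊆ S' → G S ≤ G S' := by
    intro S S' hSS'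
    have h1 : F S ≤ F S' := hF S S' hSS'
    have h2 : (if S' ⊆ T then (1 : ℝ) else 0) ≤ (if S ⊆ T then 1 else 0) := by
      by_cases hS' : S' ⊆ T
      · rw [if_pos hS', if_pos (hSS'.trans hS')]
      · rw [if_neg hS']; split_ifs <;> norm_num
    show F S - t * (if S ⊆ T then 1 else 0) ≤ F S' - t * (if S' ⊆ T then 1 else 0)
    nlinarith
  -- the means and restricted integrals as finite sums of point masses, continuous in the parameters
  set M : Fin n → (Sym2 (Fin n) → unitInterval) → ℝ := fun a p =>
    ∑ ω, BHK2006.rcMass p q ω * G (openCluster ω a) with hM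
  set f : Fin n → (Sym2 (Fin n) → unitInterval) → ℝ := fun a p =>
    ∑ ω, BHK2006.rcMass p q ω * (G (openCluster ω a) * DecisionTree.ind J ω) with hf
  have hMcont : ∀ a, Continuous (M a) := fun a => BHK2006.continuous_sum_rcMass hq0 _
  have hfcont : ∀ a, Continuous (f a) := fun a => BHK2006.continuous_sum_rcMass hq0 _
  have hMint : ∀ (a : Fin n) (p : Sym2 (Fin n) → unitInterval), M a p = ∫ ω, G (openCluster ω a) ∂(rcMeasureW p q ∅) :=
    fun a p => (BHK2006.integral_rcMeasureW_eq_sum p hq0 _).symm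
  have hfint : ∀ (a : Fin n) (p : Sym2 (Fin n) → unitInterval), f a p = ∫ ω in J, G (openCluster ω a) ∂(rcMeasureW p q ∅) :=
    fun a p => (BHK2006.setIntegral_rcMeasureW_eq_sum p hq0 _ J).symm
  -- relays of `A ∩ T` are interchangeable with `c`
  set B : Finset (Fin n) := A.filter (fun a => a ∈ T) with hB
  have hcB : c ∈ B := Finset.mem_filter.2 ⟨hcA, hcT⟩
  have hae : ∀ a ∈ B, ∀ᵐ ω ∂μ, G (openCluster ω a) = G (openCluster ω c) := by
    intro a ha
    filter_upwards [openCluster_ae_eq_of_real_openConn_eq_one' μ (Finset.mem_filter.1 ha).2] with ω hω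
    rw [hω]
  have hMB : ∀ a ∈ B, M a w = M c w := fun a ha => by
    rw [hMint, hMint]; exact integral_congr_ae (hae a ha)
  have hfB : ∀ a ∈ B, f a w = f c w := fun a ha => by
    rw [hfint, hfint]; exact integral_congr_ae (ae_restrict_of_ae (hae a ha))
  -- at `w`: `M c w = m_c − t φ(C c ⊆ T)` and `M a w = m_a ≥ m_c` for `a ∈ A ∖ T`
  have hMc : M c w = (∫ ω, F (openCluster ω c) ∂μ) - t * μ.real {ω : BondConfig (Fin n) | openCluster ω c ⊆ T} := by
    rw [hMint]
    show (∫ ω, (F (openCluster ω c) - t * (if openCluster ω c ⊆ T then 1 else 0)) ∂μ) = _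
    rw [integral_sub (hint _ _) (hint _ _), integral_const_mul]
    congr 2
    have : (fun ω : BondConfig (Fin n) => (if openCluster ω c ⊆ T then (1 : ℝ) else 0)) =
        {ω : BondConfig (Fin n) | openCluster ω c ⊆ T}.indicator 1 := by
      funext ω
      by_cases hω : openCluster ω c ⊆ T
      · rw [if_pos hω, indicator_of_mem (show ω ∈ {ω : BondConfig (Fin n) | openCluster ω c ⊆ T} from hω), Pi.one_apply]
      · rw [if_neg hω, indicator_of_notMem (show ω ∉ {ω : BondConfig (Fin n) | openCluster ω c ⊆ T} from hω)]
    rw [this, integral_indicator_one (hmeas _)]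
  have hMa : ∀ a ∈ A, a ∉ T → M a w = ∫ ω, F (openCluster ω a) ∂μ := by
    intro a _ haT
    rw [hMint]
    refine integral_congr_ae (Eventually.of_forall fun ω => ?_)
    have : ¬ openCluster ω a ⊆ T := fun h => haT (h (mem_openCluster_self ω a))
    show F (openCluster ω a) - t * (if openCluster ω a ⊆ T then 1 else 0) = F (openCluster ω a)
    rw [if_neg this, mul_zero, sub_zero]
  have hgap : ∀ a' ∈ B, ∀ a ∈ A, a ∉ T → M a' w < M a w := by
    intro a' ha' a ha haT
    rw [hMB a' ha', hMc, hMa a ha haT]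
    have := hmin a ha
    nlinarith [mul_pos ht hpos]
  -- the gap persists near `w`; there the hypothesis applies to a minimiser, which lies in `A ∩ T`
  set S : Set (Sym2 (Fin n) → unitInterval) := {p | ∀ e, 0 < p e ∧ p e < 1} with hS
  have hwS : w ∈ closure S := dense_setOf_weights_pos_lt_one w
  have hnear : ∀ᶠ p in 𝓝[S] w, ∀ a' ∈ B, ∀ a ∈ A.filter (fun a => a ∉ T), M a' p < M a p := by
    refine eventually_nhdsWithin_of_eventually_nhds ?_
    refine (Finset.eventually_all B).2 fun a' ha' => (Finset.eventually_all _).2 fun a ha => ?_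
    have ha2 := Finset.mem_filter.1 ha
    exact Filter.Tendsto.eventually_lt ((hMcont a').continuousAt) ((hMcont a).continuousAt)
      (hgap a' ha' a ha2.1 ha2.2)
  have hinS : ∀ᶠ p in 𝓝[S] w, p ∈ S := eventually_mem_nhdsWithin
  have hev : ∀ᶠ p in 𝓝[S] w, ∃ a ∈ B, f a p ≤ f o p := by
    filter_upwards [hnear, hinS] with p hp hpS
    obtain ⟨cp, hcpA, hcpmin⟩ := A.exists_min_image (fun a => M a p) ⟨c, hcA⟩
    have hcpT : cp ∈ T := by
      by_contra h
      have h1 := hp c hcB cp (Finset.mem_filter.2 ⟨hcpA, h⟩)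
      have h2 := hcpmin c hcA
      exact absurd h2 (not_le.2 h1)
    refine ⟨cp, Finset.mem_filter.2 ⟨hcpA, hcpT⟩, ?_⟩
    rw [hfint, hfint]
    exact hND p hpS A o cp G hGmono hcpA (fun a ha => by rw [← hMint, ← hMint]; exact hcpmin a ha)
  -- pass to the limit `p → w` and transfer to `c`
  obtain ⟨a, haB, hle⟩ := Q7Psi.exists_le_of_eventually_exists_le B f (f o) (fun a _ => hfcont a) (hfcont o) hwS hev
  rw [hfB a haB, hfint, hfint] at hle
  -- unfold `G` in the two restricted integrals
  have hsplit : ∀ x : Fin n, (∫ ω in J, G (openCluster ω x) ∂μ) = (∫ ω in J, F (openCluster ω x) ∂μ) -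
      t * ∫ ω in J, (if openCluster ω x ⊆ T then (1 : ℝ) else 0) ∂μ := by
    intro x
    show (∫ ω in J, (F (openCluster ω x) - t * (if openCluster ω x ⊆ T then 1 else 0)) ∂μ) = _
    rw [integral_sub (hint _ _) (hint _ _), integral_const_mul]
  have hind_nonneg : ∀ x : Fin n, 0 ≤ ∫ ω in J, (if openCluster ω x ⊆ T then (1 : ℝ) else 0) ∂μ :=
    fun x => integral_nonneg fun ω => by positivity
  have hind_le : ∀ x : Fin n, ∫ ω in J, (if openCluster ω x ⊆ T then (1 : ℝ) else 0) ∂μ ≤ 1 := by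
    intro x
    calc ∫ ω in J, (if openCluster ω x ⊆ T then (1 : ℝ) else 0) ∂μ ≤ ∫ ω in J, (1 : ℝ) ∂μ :=
          integral_mono (hint _ _) (hint _ _) fun ω => by
            show (if openCluster ω x ⊆ T then (1 : ℝ) else 0) ≤ 1
            split_ifs <;> norm_num
      _ = μ.real J := by rw [setIntegral_const, smul_eq_mul, mul_one]
      _ ≤ 1 := measureReal_le_one
  rw [hsplit c, hsplit o] at hle
  nlinarith [hind_nonneg c, hind_le c, hind_nonneg o, hind_le o]

/-- **KOZMA–NITZAN'S CONJECTURE 4 IN DESIGNATED FORM FOR EVERY `φ_{w,q}`, `q ≥ 1`, EVERY `w ∈ [0,1]^{Sym2 (Fin n)}`**: for a monotone real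
cluster property `F`, a relay set `A`, an observer `o` and a relay `c ∈ A` of least mean (`E_φ F(C c) ≤ E_φ F(C a)`, `a ∈ A`):
`E_φ[F(C(c)); 0 ↔ A] ≤ E_φ[F(C(0)); 0 ↔ A]`.  (= `FK.kn_conj4_designated_rc_nondegenerate` carried to all parameters by `FK.gpsi_rc_of_nondegenerate`;
at `q = 1` this is `Q7Psi.kn_conj4_designated`, builds on p205010 (kernel theorem, internal audit signed; external expert review pending).)
[cite: KozmaNitzan2024, Conj. 4 (p. 32), Question 7 (p. 36)] [cite: Grimmett2006, §1.4 eq. (1.20) (p. 15)] -/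
theorem kn_conj4_designated_rc {q : ℝ} (hq : 1 ≤ q) (w : Sym2 (Fin n) → unitInterval) (A : Finset (Fin n)) (o c : Fin n)
    (F : Set (Fin n) → ℝ) (hF : ∀ S T : Set (Fin n), S ⊆ T → F S ≤ F T) (hcA : c ∈ A)
    (hcmin : ∀ a ∈ A, ∫ ω, F (openCluster ω c) ∂(rcMeasureW w q ∅) ≤ ∫ ω, F (openCluster ω a) ∂(rcMeasureW w q ∅)) :
    ∫ ω in ⋃ a' ∈ A, openConn o a', F (openCluster ω c) ∂(rcMeasureW w q ∅) ≤
      ∫ ω in ⋃ a' ∈ A, openConn o a', F (openCluster ω o) ∂(rcMeasureW w q ∅) :=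
  gpsi_rc_of_nondegenerate hq (fun p hp A' o' c' F' hF' hc' hmin' => kn_conj4_designated_rc_nondegenerate hq p hp A' o' c' F' hF' hc' hmin')
    w A o c F hF hcA hcmin

/-- **KOZMA–NITZAN'S QUESTION 7 FOR EVERY RANDOM-CLUSTER MEASURE `φ_{w,q}`, `q ≥ 1`** (every `w ∈ [0,1]^{Sym2 (Fin n)}`, every `|A|`): if `c ∈ A` is a
least `b`-reliable relay (`φ(c ↔ b) ≤ φ(a ↔ b)`, `a ∈ A`), then the pre-FKG inequality (41) holds: `φ({c ↔ b} ∩ {0 ↔ A}) ≤ φ({0 ↔ b} ∩ {0 ↔ A})`.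
At `q = 1` this is `Q7Psi.kn_question7` (builds on p205010 (kernel theorem, internal audit signed; external expert review pending)).
[cite: KozmaNitzan2024, Question 7 and display (41) (p. 36)] [cite: Grimmett2006, §1.4 eq. (1.20) (p. 15)] -/
theorem kn_question7_rc {q : ℝ} (hq : 1 ≤ q) (w : Sym2 (Fin n) → unitInterval) (A : Finset (Fin n)) (o b c : Fin n) (hcA : c ∈ A)
    (hcmin : ∀ a ∈ A, (rcMeasureW w q ∅).real (openConn c b) ≤ (rcMeasureW w q ∅).real (openConn a b)) :
    (rcMeasureW w q ∅).real (openConn c b ∩ ⋃ a' ∈ A, openConn o a') ≤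
      (rcMeasureW w q ∅).real (openConn o b ∩ ⋃ a' ∈ A, openConn o a') := by
  classical
  have hq0 : 0 < q := one_pos.trans_le hq
  haveI := isProbabilityMeasure_rcMeasureW w hq0 (∅ : Set (Fin n))
  have hmeas : ∀ S : Set (BondConfig (Fin n)), MeasurableSet S := fun _ => MeasurableSet.of_discrete
  set Fb : Set (Fin n) → ℝ := fun S => if b ∈ S then (1 : ℝ) else 0 with hFb
  have hF : ∀ S T : Set (Fin n), S ⊆ T → Fb S ≤ Fb T := by
    intro S T hST
    simp only [hFb]
    by_cases hS : b ∈ S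
    · simp [hS, hST hS]
    · by_cases hT : b ∈ T
      · simp [hS, hT]
      · simp [hS, hT]
  have hfun : ∀ x : Fin n, (fun ω : BondConfig (Fin n) => Fb (openCluster ω x)) = (openConn x b : Set (BondConfig (Fin n))).indicator 1 := by
    intro x
    funext ω
    simp only [hFb]
    by_cases h : ω ∈ (openConn x b : Set (BondConfig (Fin n)))
    · rw [indicator_of_mem h, Pi.one_apply, if_pos (show b ∈ openCluster ω x from h)]
    · rw [indicator_of_notMem h, if_neg (show b ∉ openCluster ω x from h)]
  have hid : ∀ x : Fin n, ∫ ω in ⋃ a' ∈ A, openConn o a', Fb (openCluster ω x) ∂(rcMeasureW w q ∅) =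
      (rcMeasureW w q ∅).real (openConn x b ∩ ⋃ a' ∈ A, openConn o a') := by
    intro x
    rw [hfun x, KNPreFKG.setIntegral_indicator_one_eq, inter_comm]
  have hid0 : ∀ x : Fin n, ∫ ω, Fb (openCluster ω x) ∂(rcMeasureW w q ∅) = (rcMeasureW w q ∅).real (openConn x b) := by
    intro x
    rw [hfun x, integral_indicator_one (hmeas _)]
  have h := kn_conj4_designated_rc hq w A o c Fb hF hcA (fun a ha => by rw [hid0, hid0]; exact hcmin a ha)
  rw [hid c, hid o] at h
  exact h

/-- **Kozma–Nitzan's Conjecture 2 / display (3) with the witness NAMED, for `φ_{w,q}`, `q ≥ 1`, every `w`**: the a-priori least `b`-reliable relay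
`c ∈ A` satisfies `φ(c ↔ b, 0 ↔ A) ≤ φ(0 ↔ b, 0 ↔ A)` (so `FK.kn_conj2_rc`'s `∃ a` can always be taken to be this `c`).
[cite: KozmaNitzan2024, Conj. 2 / display (3) (p. 3), Question 7 (p. 36)] -/
theorem kn_conj2_designated_rc {q : ℝ} (hq : 1 ≤ q) (w : Sym2 (Fin n) → unitInterval) (A : Finset (Fin n)) (o b : Fin n) (hA : A.Nonempty) :
    ∃ c ∈ A, (∀ a ∈ A, (rcMeasureW w q ∅).real (openConn c b) ≤ (rcMeasureW w q ∅).real (openConn a b)) ∧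
      (rcMeasureW w q ∅).real (openConn c b ∩ ⋃ a' ∈ A, openConn o a') ≤
        (rcMeasureW w q ∅).real (openConn o b ∩ ⋃ a' ∈ A, openConn o a') := by
  obtain ⟨c, hcA, hcmin⟩ := Finset.exists_min_image A (fun a => (rcMeasureW w q ∅).real (openConn a b)) hA
  exact ⟨c, hcA, hcmin, kn_question7_rc hq w A o b c hcA hcmin⟩

end FK

end

end Summit.CriticalPhenomena.PercolationContinuityZ3.Theorems
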